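import Literature.MathematicalPhysics.QuantumFieldTheory.Balaban1983to89.B9Thm311OpenAtFlatHolonomyZdPer
import Literature.MathematicalPhysics.QuantumFieldTheory.Balaban1983to89.B9Thm31CoercivePrimeCompactZd

/-!
# `Balaban1983to89.B9Thm311ClassCompactnessZdPer` — [Balaban1985BackgroundPropagators] Thm 3.11 p. 416 ∕ (3.27) p. 395 ON THE TORUS `T_P` READ ON `ℤᵈ`,
# FOR THE WHOLE SMALL-FIELD CLASS (1.7), PER MEMBER: the junction's binder `RegularInClassAtHPer` ∕ `InvAtHIPer … aI` (dag-n06-b g22 `B9Eq327GreenZdHermPer`)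
# is INHABITED for the GENUINE four-letter periodic record `opsAllZdPer` at lit-balaban's torus member `torusIdx` — there is ONE threshold `aI > 0`
# (member-, `P`-, `τ`-dependent) such that `G_𝔤^per(U₀) = (Δ_a(U₀))⁻¹` exists at EVERY `P`-periodic unitary background `U₀ ∈ 𝔄_m({T}, α₀)`, `α₀ ≤ aI` —
# by COMPACTNESS of the periodic unitary backgrounds (Tychonoff over the finite-dimensional C⋆ fibre) applied to the openness of `RegularAtHPer` at every FLAT
# background (`B9Thm311OpenAtFlatHolonomyZdPer`, any holonomy) within the canonical regime set

statement-level skeleton of published theorems with citation tags; proofs where landed; nothing here is a claim about the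
Yang–Mills mass gap

`[Balaban1985BackgroundPropagators]` ("B9", CMP **99** (1985) 389–434) Thm 3.11 p. 416: *«There exist constants M₀, α₀′ such that for M ≥ M₀, Mα₀ ≤ α₀′ and
for U satisfying (3.35) the operators Δ′_a, G′, Q′G′²Q′*, (Q′G′²Q′*)⁻¹, Δ_a, G are positive definite … uniformly in U, Ω_j»*; (3.26)–(3.27) p. 395.
`[Balaban1985RegularSpaces]` (1.7) p. 77 *«|U(∂p) − 1| < α₀L^{−2j} for p ∈ Ω_j»* (the class `𝔄_k({Ω_j}, α₀)`), p. 77 *«Ω_j = T_η»*, (1.58) p. 86.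
`[Balaban1985Averaging]` Prop. 2 (52)–(54) p. 26 (the averaged configurations of a class background are unitary).  PDF held:
`paper:balaban1985-cmp99-background-propagators` pp. 395, 416.

CITATION HEADER (lean-in-tree rule).  Cell `pub-ymgap` (YM Track A), DAG node N06 = [B9], seat `pub-ymgap-dag-n06-b` (g24), the (β′-PERIODIC) road
(director-ym №217 (1)); HANDOFF-dag-n06-b §2q WHAT REMAINS (1).  WHY: the periodic socket for the genuine torus record (`B9SupplySockB9P3ZdPer.sockB9P3Per_opsAllZdPer_of_binders`,
`B9SupplySockB9P3ZdH2Per.sockB9P3H2Per_opsAllZdPer_of_binders`) displays THREE binders; the first, `hinv : InvAtHIPer P L (opsAllZdPer τ L P i.Λb ops₀) aI M i m`,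
is Theorem 3.11's content at the member.  Until now it was proved only NEAR `U₀ = 1` (dag-n06-w4 `B9Thm311PosDefOpenZdPer`) and AT the flat backgrounds
(dag-n06-b g23 `B9Thm311FlatHolonomyKernelZdPer`); the class (1.7) contains flat backgrounds with non-trivial holonomy, so neither covers the class.  THIS FILE
closes the QUALITATIVE statement for the whole class per member: the FLAT SET `F = {U₀ unitary, P-periodic, all plaquette variables 1}` is compact and
`= ⋂_{α>0} {plaquettes α-close to 1}`; `RegularAtHPer` holds on an open neighbourhood of `F` within the canonical regime set (FILE 1 at every point of `F`);
a decreasing-closed-sets argument (`IsCompact.nonempty_iInter_of_sequence_nonempty_isCompact_isClosed`) makes that neighbourhood swallow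
`{plaquettes α-close}` for some `α > 0`, and `𝔄_m({T}, α₀) ⊂ {plaquettes α₀-close} ∩ (canonical regime set)` for `α₀ ≤ min α (α_Q∕L²)` ((1.7) level `0`;
`reg17_of_inAk`; [B7] Prop. 2 `bgT_mem_unitaryUnits_of_reg17UnivP`).  NO closedness of `InAk` and NO continuity of the averages on the class is used — only the
level-`0` plaquette clause of (1.7).  Nothing is re-declared.

WHAT IS PROVED (kernel, 0 sorry; theorems only — no `def`, no `instance`, no `notation`).
* §1 (topology of backgrounds, product topology on `ℤᵈ × {directions} → 𝔸ˣ`) `isClosed_isPeriodic`, ★ `isCompact_unitaryPeriodic` (the `P`-periodic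
  unitary backgrounds: a closed subset of the compact `Π unitary(𝔸)` of dag-n06-w4's `B9Eq335UnitaryClassCompactZd.isCompact_setOf_forall_mem_unitaryUnits`),
  `isClosed_flat` (dag-n06-w4's `B9Thm31CoercivePrimeCompactZd.continuous_plaqF`; the `α`-close sets are their `isClosed_setOf_forall_plaqF_le`).
* §2 ★★ `exists_plaq_threshold_of_open_superset_flat` (THE SWALLOWING LEMMA: an open set containing every flat periodic unitary background contains every
  periodic unitary background whose plaquette variables are `α`-close to `1`, for some `α > 0`).
* §3 `plaq_near_of_inAk_univ` (the level-`0` clause of (1.7) on `Ω₀ = ℤᵈ`), `mem_canonical_of_inAk_torusIdx` (a class background at `α₀ ≤ α_Q∕L²` lies in the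
  canonical regime set: `Reg17` by monotonicity, `Ū₀ʲ(Γ)` unitary by [B7] Prop. 2), ★★★★ `regularInClassAtHPer_opsAllZdPer_torusIdx`
  (`∃ aI > 0, RegularInClassAtHPer P L (opsLandauPer τ P (withDpZd (withQQP τ L torusLamb ops₀))) aI M (torusIdx t) m` — THEOREM 3.11 ON THE TORUS FOR THE
  WHOLE CLASS (1.7) AT THE MEMBER, for the genuine record: `0 < d`, `2 ≤ L`, `Lᵐ ∣ P`, faithful Hermitian tracial `τ`, finite-dimensional non-trivial fibre),
  ★★★★ `invAtHIPer_opsAllZdPer_torusIdx` (`∃ aI > 0, InvAtHIPer P L (opsAllZdPer τ L P torusLamb ops₀) aI M (torusIdx t) m` — THE JUNCTION'S (3.27) BINDER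
  INHABITED ON THE TORUS; the `hinv` input of `sockB9P3Per_opsAllZdPer_of_binders` ∕ `sockB9P3H2Per_opsAllZdPer_of_binders` at `torusIdx` is a THEOREM),
  `invAtHIPer_opsAllZdPer_torusIdx_Λb` (the same keyed on `(torusIdx t).Λb`, the consumers' literal class token).

HONEST SCOPE.  (i) QUALITATIVE: `aI` exists by compactness and is member-, `P`-, `τ`- and record-dependent; print's Theorem 3.11 is UNIFORM (`M₀, α₀′`
independent of the volume) — that uniformity ((3.115), Sects. B–E; the coercivity road of dag-n06-w3∕w4) is NOT proved here; no estimate of [B9] (Thm 3.1 ∕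
3.3 ∕ (3.42) NOT proved).  (ii) The other two binders of the periodic socket (`GlobAtIPer`, `HolderAtIPer`∕`HolderAtIH2Per` = Thm 3.3's (3.42)∕(3.47) and
(3.43) for the genuine `G_𝔤^per`) are NOT touched.  (iii) `0 < d` is displayed (used only for [B7] Prop. 2's plaquette supremum).  (iv) Count-neutral;
N05 ∕ N06 NOT discharged; K1⁹ `stmt-QuantumFields-27364` NOT closed; one finite `𝕋⁴` programme at fixed `ε`, Bałaban as printed; R4 closes only the
conditional finite-`𝕋⁴` rung `BalabanLadder.UV` — nothing continuum ∕ ℝ⁴ ∕ OS ∕ mass gap ∕ Clay.  Unit `pub-ymgap-dag-n06-b` (g24), 2026-08-28.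
-/

noncomputable section

namespace Literature.MathematicalPhysics.QuantumFieldTheory.Balaban1983to89.B9Thm311ClassCompactnessZdPer

open Filter Topology
open B7Prop1Explicit B7Eq78Linearization
open B7Prop2Explicit (unitaryUnits mem_unitaryUnits)
open B8Ineq132 (plaqF InAk)
open B8Eq119TwistedAxial (bgT)
open B8LeafModelZd (ZdIdx)
open T4TermwiseTorus (IsPeriodic)
open B9SupplySockB9P3ZdLetters (OpsZd)
open B9SupplySockB9P3ZdGammaInAkDpZd (withDpZd)
open B9Eq316AveragingTransposeZd (Reg17 alphaQ alphaQ_pos reg17_of_inAk reg17_mono)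
open B9Eq316AveragingTransposeZdPrinted (withQQP)
open B9Eq327GreenZdHermPer (RegularAtHPer RegularInClassAtHPer InvAtHIPer invAtHIPer_withGopZdHPer)
open B9SupplySockB9P3ZdAllLettersZdPer (opsLandauPer opsAllZdPer)
open B9Thm311OpenAtFlatHolonomyZdPer (regularAtHPer_eventually_torusIdx_canonical_of_flat)
open B8Thm4TorusAt (torusLam)
open B8Thm2TorusMember (TorusMember torusIdx torusLamb)

-- `Site` alone could resolve to the torus sites of `Setup.lean`; re-export the `ℤ^d` sites of `B7Prop1Explicit`.
export B7Prop1Explicit (Site)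

variable {d : ℕ} {𝔸 : Type*} [CStarAlgebra 𝔸]

/-! ## §1  Topology of the unitary periodic backgrounds -/

section Topology

/-- **`P`-PERIODICITY IS A CLOSED CONDITION** in the product topology (equality of coordinates). [cite: Balaban1985RegularSpaces, p.77 («Ω_j = T_η»: gauge fields on the torus), bookkeeping] -/
theorem isClosed_isPeriodic (P : ℕ) : IsClosed {U : Site d → Fin d → 𝔸ˣ | IsPeriodic P U} := by
  have hset : {U : Site d → Fin d → 𝔸ˣ | IsPeriodic P U} = ⋂ (x : Site d), ⋂ (n : Site d), {U : Site d → Fin d → 𝔸ˣ | U (x + (P : ℤ) • n) = U x} := by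
    ext U
    simp only [Set.mem_setOf_eq, Set.mem_iInter, IsPeriodic]
  rw [hset]
  exact isClosed_iInter fun x => isClosed_iInter fun n => isClosed_eq (continuous_apply _) (continuous_apply _)

/-- ★ **THE `P`-PERIODIC UNITARY BACKGROUNDS FORM A COMPACT SET** in the product topology of `ℤᵈ × {directions} → 𝔸ˣ`: a closed subset of the compact
product `Π unitary(𝔸)` (Tychonoff; dag-n06-w4's `isCompact_setOf_forall_mem_unitaryUnits`). [cite: Balaban1985RegularSpaces, p.77 («Ω_j = T_η»); Balaban1985BackgroundPropagators, (3.35) p.396] -/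
theorem isCompact_unitaryPeriodic [FiniteDimensional ℝ 𝔸] [Nontrivial 𝔸] (P : ℕ) :
    IsCompact {U : Site d → Fin d → 𝔸ˣ | (∀ (x : Site d) (κ : Fin d), U x κ ∈ unitaryUnits 𝔸) ∧ IsPeriodic P U} := by
  rw [Set.setOf_and]
  exact B9Eq335UnitaryClassCompactZd.isCompact_setOf_forall_mem_unitaryUnits.inter_right (isClosed_isPeriodic P)

/-- **THE FLAT SET IS CLOSED** (all plaquette variables `1`; each is a continuous function of the background — dag-n06-w4's `continuous_plaqF`).
[cite: Balaban1985RegularSpaces, (1.7) p.77] -/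
theorem isClosed_flat : IsClosed {U : Site d → Fin d → 𝔸ˣ | ∀ (κ ν : Fin d) (x : Site d), plaqF U κ ν x = 1} := by
  have hset : {U : Site d → Fin d → 𝔸ˣ | ∀ (κ ν : Fin d) (x : Site d), plaqF U κ ν x = 1} =
      ⋂ (κ : Fin d), ⋂ (ν : Fin d), ⋂ (x : Site d), {U : Site d → Fin d → 𝔸ˣ | plaqF U κ ν x = 1} := by
    ext U
    simp only [Set.mem_setOf_eq, Set.mem_iInter]
  rw [hset]
  exact isClosed_iInter fun κ => isClosed_iInter fun ν => isClosed_iInter fun x =>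
    isClosed_eq (B9Thm31CoercivePrimeCompactZd.continuous_plaqF κ ν x) continuous_const

end Topology

/-! ## §2  The swallowing lemma: an open neighbourhood of the flat set contains a small-plaquette class -/

section Swallow

variable [FiniteDimensional ℝ 𝔸] [Nontrivial 𝔸]

/-- ★★ **THE SWALLOWING LEMMA**: if an OPEN set `N` of backgrounds contains every FLAT `P`-periodic unitary background (plaquette variables `≡ 1`, any
holonomy), then for some `α > 0` it contains every `P`-periodic unitary background ALL of whose plaquette variables are `α`-close to `1` — the compact sets
`Kₙ = {unitary, periodic, ∉ N, plaquettes (n+1)⁻¹-close}` decrease to a subset of the flat set, which `N` contains, so one of them is empty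
(`IsCompact.nonempty_iInter_of_sequence_nonempty_isCompact_isClosed`).  This is how the class (1.7) «shrinks onto the flat backgrounds as α₀ → 0» is used.
[cite: Balaban1985RegularSpaces, (1.7) p.77; Balaban1985BackgroundPropagators, Thm 3.11 p.416] -/
theorem exists_plaq_threshold_of_open_superset_flat (P : ℕ) {N : Set (Site d → Fin d → 𝔸ˣ)} (hN : IsOpen N)
    (hflatN : ∀ U : Site d → Fin d → 𝔸ˣ, (∀ (x : Site d) (κ : Fin d), U x κ ∈ unitaryUnits 𝔸) → IsPeriodic P U →
      (∀ (κ ν : Fin d) (x : Site d), plaqF U κ ν x = 1) → U ∈ N) :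
    ∃ α : ℝ, 0 < α ∧ ∀ U : Site d → Fin d → 𝔸ˣ, (∀ (x : Site d) (κ : Fin d), U x κ ∈ unitaryUnits 𝔸) → IsPeriodic P U →
      (∀ (x : Site d) (κ ν : Fin d), ‖plaqF U κ ν x - 1‖ ≤ α) → U ∈ N := by
  by_contra hcon
  push Not at hcon
  -- `hcon : ∀ α, 0 < α → ∃ U, unitary ∧ periodic ∧ (plaquettes α-close) ∧ U ∉ N`
  set K : Set (Site d → Fin d → 𝔸ˣ) := {U | (∀ (x : Site d) (κ : Fin d), U x κ ∈ unitaryUnits 𝔸) ∧ IsPeriodic P U} with hK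
  set t : ℕ → Set (Site d → Fin d → 𝔸ˣ) := fun n =>
    (K ∩ Nᶜ) ∩ {U | ∀ (x : Site d) (κ ν : Fin d), ‖plaqF U κ ν x - 1‖ ≤ ((n : ℝ) + 1)⁻¹} with ht
  have htd : ∀ n, t (n + 1) ⊆ t n := by
    intro n U hU
    refine ⟨hU.1, fun x κ ν => (hU.2 x κ ν).trans ?_⟩
    push_cast
    exact inv_anti₀ (by positivity) (by linarith)
  have htn : ∀ n, (t n).Nonempty := by
    intro n
    obtain ⟨U, hUu, hUp, hUs, hUN⟩ := hcon (((n : ℝ) + 1)⁻¹) (by positivity)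
    exact ⟨U, ⟨⟨hUu, hUp⟩, hUN⟩, hUs⟩
  have hKc : IsCompact K := isCompact_unitaryPeriodic P
  have ht0 : IsCompact (t 0) :=
    (hKc.inter_right hN.isClosed_compl).inter_right (B9Thm31CoercivePrimeCompactZd.isClosed_setOf_forall_plaqF_le _)
  have htcl : ∀ n, IsClosed (t n) := fun n =>
    (hKc.isClosed.inter hN.isClosed_compl).inter (B9Thm31CoercivePrimeCompactZd.isClosed_setOf_forall_plaqF_le _)
  obtain ⟨U, hU⟩ := IsCompact.nonempty_iInter_of_sequence_nonempty_isCompact_isClosed t htd htn ht0 htcl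
  rw [Set.mem_iInter] at hU
  have hU0 := hU 0
  -- `U` is flat
  have hflat : ∀ (κ ν : Fin d) (x : Site d), plaqF U κ ν x = 1 := by
    intro κ ν x
    by_contra hne
    have hpos : 0 < ‖plaqF U κ ν x - 1‖ := norm_pos_iff.2 (sub_ne_zero.2 hne)
    obtain ⟨n, hn⟩ := exists_nat_one_div_lt hpos
    have hle := (hU n).2 x κ ν
    rw [one_div] at hn
    exact absurd (lt_of_le_of_lt hle hn) (lt_irrefl _)
  exact hU0.1.2 (hflatN U hU0.1.1.1 hU0.1.1.2 hflat)

end Swallow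

/-! ## §3  Theorem 3.11 on the torus for the whole class (1.7) at the member `torusIdx`: the junction's binder inhabited -/

section Class

variable [FiniteDimensional ℝ 𝔸] [Nontrivial 𝔸] (τ : 𝔸 →ₗ[ℂ] ℂ) (hτp : ∀ a : 𝔸, a ≠ 0 → 0 < (τ (star a * a)).re)
  (hτt : ∀ a b : 𝔸, τ (a * b) = τ (b * a)) (hτs : ∀ a : 𝔸, τ (star a) = starRingEnd ℂ (τ a)) {L P : ℕ} [NeZero P] [NeZero L]

omit [FiniteDimensional ℝ 𝔸] [Nontrivial 𝔸] [NeZero P] [NeZero L] in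
/-- **THE LEVEL-`0` CLAUSE OF (1.7) ON `Ω₀ = ℤᵈ`**: a background of `𝔄_m({ℤᵈ}, α₀)` has EVERY plaquette variable `α₀`-close to `1` (`L⁰ = 1`; the diagonal
`κ = ν` is the empty plaquette). [cite: Balaban1985RegularSpaces, (1.7) p.77, p.77 («Ω_j = T_η»)] -/
theorem plaq_near_of_inAk_univ {m : ℕ} {η α₀ : ℝ} (hα₀ : 0 ≤ α₀) {U₀ : Site d → Fin d → 𝔸ˣ}
    (hIn : InAk L m η α₀ (fun _ => (Set.univ : Set (Site d))) U₀) (κ ν : Fin d) (x : Site d) : ‖plaqF U₀ κ ν x - 1‖ ≤ α₀ := by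
  by_cases hκν : κ = ν
  · subst hκν
    unfold plaqF
    rw [B7Prop2Explicit.hol_plaqWord_self, Units.val_one, sub_self, norm_zero]
    exact hα₀
  · have h := (hIn 0 (Nat.zero_le m)).1 x κ ν hκν (Or.inl (Set.mem_univ x))
    simp only [pow_zero, inv_one, one_pow, mul_one] at h
    exact h.le

omit [FiniteDimensional ℝ 𝔸] [NeZero P] [NeZero L] in
/-- **A CLASS BACKGROUND AT A SMALL THRESHOLD LIES IN THE CANONICAL REGIME SET OF THE TORUS MEMBER**: for `α₀ ≤ α_Q∕L²`, `0 < d`, `2 ≤ L`, a unitary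
`P`-periodic `U₀ ∈ 𝔄_m({ℤᵈ}, α₀)` has `Reg17 L m (ℤᵈ) (α_Q∕L²)` (monotonicity of (1.7)) and unitary averaged transporters `Ū₀ʲ(Γ)`, `j ≤ m` ([Balaban1985Averaging]
Prop. 2, dag-n06-w4's `bgT_mem_unitaryUnits_of_reg17UnivP`). [cite: Balaban1985RegularSpaces, (1.7) p.77, (1.29) p.81; Balaban1985Averaging, Prop. 2 (52)–(54) p.26] -/
theorem mem_canonical_of_inAk_torusIdx (hd : 0 < d) (hL2 : 2 ≤ L) (t : TorusMember) (m : ℕ) {α₀ : ℝ} (hα₀ : α₀ ≤ alphaQ d L / (L : ℝ) ^ 2)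
    {U₀ : Site d → Fin d → 𝔸ˣ} (hU₀ : ∀ (x : Site d) (κ : Fin d), U₀ x κ ∈ unitaryUnits 𝔸) (hper : IsPeriodic P U₀)
    (hIn : InAk L m (torusIdx (d := d) (le_trans (by norm_num) hL2) t).η α₀ (torusIdx (d := d) (le_trans (by norm_num) hL2) t).Ω U₀) :
    U₀ ∈ {U₀ : Site d → Fin d → 𝔸ˣ | (∀ (x : Site d) (κ : Fin d), U₀ x κ ∈ unitaryUnits 𝔸) ∧ IsPeriodic P U₀ ∧
        Reg17 L m (torusIdx (d := d) (le_trans (by norm_num) hL2) t).Ω (alphaQ d L / (L : ℝ) ^ 2) U₀ ∧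
        ∀ j, j ≤ m → ∀ (x y : Site d), bgT L U₀ j x y ∈ unitaryUnits 𝔸} := by
  have hreg : Reg17 L m (torusIdx (d := d) (le_trans (by norm_num) hL2) t).Ω (alphaQ d L / (L : ℝ) ^ 2) U₀ :=
    reg17_mono hα₀ (reg17_of_inAk hIn le_rfl)
  refine ⟨hU₀, hper, hreg, ?_⟩
  exact B9Thm311PosDefNearFlatZd.bgT_mem_unitaryUnits_of_reg17UnivP hd hL2 m hU₀ hreg

include hτp hτt hτs in
/-- ★★★★ **THEOREM 3.11 ON THE TORUS FOR THE WHOLE CLASS (1.7) AT THE MEMBER, FOR THE GENUINE RECORD**: for `0 < d`, `2 ≤ L`, `Lᵐ ∣ P` and a faithful Hermitian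
tracial `τ` on a finite-dimensional non-trivial fibre there is `aI > 0` such that at EVERY `P`-periodic unitary background `U₀ ∈ 𝔄_m({ℤᵈ}, α₀)` with
`α₀ ≤ aI`, `Δ_a(U₀)` of the genuine four-letter periodic record is invertible on `E_𝔤^per(P)` — `RegularInClassAtHPer` at lit-balaban's torus member `torusIdx`
(`Ω_j = ℤᵈ`, `Λ = torusLam`, class `torusLamb`).  Proof: the swallowing lemma applied to the interior `N` of `{U₀ ∈ canonical regime ⟹ RegularAtHPer}`, which
is a neighbourhood of every flat periodic unitary background by FILE 1's `regularAtHPer_eventually_torusIdx_canonical_of_flat`; `aI := min α (α_Q∕L²)`.  The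
threshold is member-dependent (compactness), NOT print's uniform `α₀′`.
[cite: Balaban1985BackgroundPropagators, Thm 3.11 p.416, (3.26)–(3.27) p.395; Balaban1985RegularSpaces, (1.7) p.77, (1.33) p.82, p.77 («Ω_j = T_η»)] -/
theorem regularInClassAtHPer_opsAllZdPer_torusIdx (hd : 0 < d) (hL2 : 2 ≤ L) (t : TorusMember) (ops₀ : ℝ → ZdIdx d L → ℕ → OpsZd d 𝔸) (M : ℝ) (m : ℕ)
    (hP : L ^ m ∣ P) :
    ∃ aI : ℝ, 0 < aI ∧ RegularInClassAtHPer P L (opsLandauPer τ P (withDpZd (withQQP τ L (fun m => torusLamb m) ops₀))) aI M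
      (torusIdx (d := d) (le_trans (by norm_num) hL2) t) m := by
  have hL1 : 1 ≤ L := le_trans (by norm_num) hL2
  have hL0 : (0 : ℝ) < L := by exact_mod_cast (lt_of_lt_of_le (by norm_num) hL2)
  set i : ZdIdx d L := torusIdx (d := d) hL1 t with hi
  -- the canonical regime set and the target property
  set 𝒰 : Set (Site d → Fin d → 𝔸ˣ) := {U₀ | (∀ (x : Site d) (κ : Fin d), U₀ x κ ∈ unitaryUnits 𝔸) ∧ IsPeriodic P U₀ ∧
      Reg17 L m i.Ω (alphaQ d L / (L : ℝ) ^ 2) U₀ ∧ ∀ j, j ≤ m → ∀ (x y : Site d), bgT L U₀ j x y ∈ unitaryUnits 𝔸} with h𝒰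
  set R : (Site d → Fin d → 𝔸ˣ) → Prop := fun U₀ =>
    RegularAtHPer t.η (opsLandauPer τ P (withDpZd (withQQP τ L (fun m => torusLamb m) ops₀)) M i m) P U₀ with hR
  -- `N` := the interior of `{U₀ | U₀ ∈ 𝒰 → R U₀}`: open, and a neighbourhood of every flat periodic unitary background
  set N : Set (Site d → Fin d → 𝔸ˣ) := interior {U₀ | U₀ ∈ 𝒰 → R U₀} with hN
  have hNopen : IsOpen N := isOpen_interior
  have hflatN : ∀ U : Site d → Fin d → 𝔸ˣ, (∀ (x : Site d) (κ : Fin d), U x κ ∈ unitaryUnits 𝔸) → IsPeriodic P U →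
      (∀ (κ ν : Fin d) (x : Site d), plaqF U κ ν x = 1) → U ∈ N := by
    intro U hUu hUp hUf
    have hev := regularAtHPer_eventually_torusIdx_canonical_of_flat τ hτp hτt hτs hL2 t ops₀ M m hP hUu hUp hUf
    rw [eventually_nhdsWithin_iff] at hev
    exact mem_interior_iff_mem_nhds.2 hev
  obtain ⟨α, hα, hswallow⟩ := exists_plaq_threshold_of_open_superset_flat P hNopen hflatN
  refine ⟨min α (alphaQ d L / (L : ℝ) ^ 2), lt_min hα (div_pos (alphaQ_pos d hL1) (pow_pos hL0 2)), ?_⟩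
  intro α₀ U₀ hU₀ hper hα₀ hIn
  have hα₀α : α₀ ≤ α := hα₀.trans (min_le_left _ _)
  have hα₀Q : α₀ ≤ alphaQ d L / (L : ℝ) ^ 2 := hα₀.trans (min_le_right _ _)
  -- the threshold of an inhabited class is positive: the covariant-divergence clause of (1.7) at level `0` is a strict bound by `α₀ · η⁻¹`
  have hα₀0 : 0 < α₀ := by
    have h := (hIn 0 (Nat.zero_le m)).2 (0 : Site d) ⟨0, hd⟩ (Or.inl (Set.mem_univ _))
    have h' : 0 < α₀ * (((L : ℝ) ^ 0)⁻¹) ^ 2 * ((L : ℝ) ^ 0 * i.η)⁻¹ := (norm_nonneg _).trans_lt h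
    simp only [pow_zero, inv_one, one_pow, mul_one, one_mul] at h'
    exact (mul_pos_iff_of_pos_right (inv_pos.2 i.hη)).1 h'
  have hnear : ∀ (x : Site d) (κ ν : Fin d), ‖plaqF U₀ κ ν x - 1‖ ≤ α :=
    fun x κ ν => (plaq_near_of_inAk_univ (L := L) hα₀0.le hIn κ ν x).trans hα₀α
  have hUN : U₀ ∈ N := hswallow U₀ hU₀ hper hnear
  have hU𝒰 : U₀ ∈ 𝒰 := mem_canonical_of_inAk_torusIdx (P := P) hd hL2 t m hα₀Q hU₀ hper hIn
  exact interior_subset hUN hU𝒰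

include hτp hτt hτs in
/-- ★★★★ **THE JUNCTION'S (3.27) BINDER INHABITED ON THE TORUS FOR THE GENUINE RECORD**: `∃ aI > 0, InvAtHIPer P L (opsAllZdPer τ L P torusLamb ops₀) aI M (torusIdx t) m`
— for every `P`-periodic unitary `U₀ ∈ 𝔄_m({ℤᵈ}, α₀)`, `α₀ ≤ aI`, every periodic Hermitian `A ∈ E(ℤᵈ)` and every `J` agreeing with `Δ_a(U₀)A` on the bonds,
`G_𝔤^per(U₀)J = A` ([Balaban1985RegularSpaces] (1.58)'s use of (3.27)); the `hinv` input of `B9SupplySockB9P3ZdPer.sockB9P3Per_opsAllZdPer_of_binders` ∕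
`B9SupplySockB9P3ZdH2Per.sockB9P3H2Per_opsAllZdPer_of_binders` at `torusIdx` is thereby a THEOREM (`0 < d`, `2 ≤ L`, `Lᵐ ∣ P`, faithful Hermitian tracial `τ`,
finite-dimensional non-trivial fibre). [cite: Balaban1985BackgroundPropagators, (3.27) p.395, Thm 3.11 p.416; Balaban1985RegularSpaces, (1.58) p.86, (1.7) p.77, p.77 («Ω_j = T_η»)] -/
theorem invAtHIPer_opsAllZdPer_torusIdx (hd : 0 < d) (hL2 : 2 ≤ L) (t : TorusMember) (ops₀ : ℝ → ZdIdx d L → ℕ → OpsZd d 𝔸) (M : ℝ) (m : ℕ)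
    (hP : L ^ m ∣ P) :
    ∃ aI : ℝ, 0 < aI ∧ InvAtHIPer P L (opsAllZdPer τ L P (fun m => torusLamb m) ops₀) aI M (torusIdx (d := d) (le_trans (by norm_num) hL2) t) m := by
  obtain ⟨aI, haI, hreg⟩ := regularInClassAtHPer_opsAllZdPer_torusIdx τ hτp hτt hτs hd hL2 t ops₀ M m hP
  exact ⟨aI, haI, invAtHIPer_withGopZdHPer P (opsLandauPer τ P (withDpZd (withQQP τ L (fun m => torusLamb m) ops₀))) M
    (torusIdx (d := d) (le_trans (by norm_num) hL2) t) m rfl hreg⟩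

include hτp hτt hτs in
/-- the same keyed on the member's own class token `(torusIdx t).Λb` (the consumers' literal `i.Λb`). [cite: Balaban1985BackgroundPropagators, (3.27) p.395, Thm 3.11 p.416; Balaban1985RegularSpaces, (1.58) p.86] -/
theorem invAtHIPer_opsAllZdPer_torusIdx_Λb (hd : 0 < d) (hL2 : 2 ≤ L) (t : TorusMember) (ops₀ : ℝ → ZdIdx d L → ℕ → OpsZd d 𝔸) (M : ℝ) (m : ℕ)
    (hP : L ^ m ∣ P) :
    ∃ aI : ℝ, 0 < aI ∧ InvAtHIPer P L (opsAllZdPer τ L P (torusIdx (d := d) (le_trans (by norm_num) hL2) t).Λb ops₀) aI M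
      (torusIdx (d := d) (le_trans (by norm_num) hL2) t) m :=
  invAtHIPer_opsAllZdPer_torusIdx τ hτp hτt hτs hd hL2 t ops₀ M m hP

end Class

end Literature.MathematicalPhysics.QuantumFieldTheory.Balaban1983to89.B9Thm311ClassCompactnessZdPer

end
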